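/-
Copyright (c) 2026 the pub-hodgecm-mathlib formalisation cell (harness21).  Prover seat hodgecm-mathlib-K2E3-p28 (g0), HCML Track B «K2-LIT» (CLOSE-OUT DAY, strike line L4
`stub_StCharTS`), h413 = `stmt-HodgeConjecture-24833`, line `K2_E3_EllipticInputs`, unit U12 «Characters», PART «SC» leaf (SC-an)₂, (M5e)₂∕(M5h)₂ chain, brick [M5](D1-split)₂:
HARISH-CHANDRA'S THEOREM 14 FOR THE SPLIT CARTAN OF `U(σ, Φ₂)(K)` — the `Fin 2` twin of ★ (M5a) `K2E3SplitTorusOrbitalBoundRankOne` (K2E3-p20 (g4)) over the ★ ring-generic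
rank-one kit `LineRing.*` (dealer K2E3-plan (g4) D143, `K2/STATUS.md` 2026-09-04T15:02:09Z).
-/
import Summits.HodgeConjecture.HodgeConjecture.Theorems.K2E3SplitTorusOrbitalBoundRankOne   -- ★ (M5a) p856869 (K2E3-p20 (g4)): the GENERIC §1 `exists_isCompact_lintegral_prod_conj_le` (any topological group), reused BY NAME; brings ★ FILE A `TorusOrbitalDescentTwist`, ★ `isInvInvariant_of_comm`, ★ `isClosed_torusU_of_t1Space`, ★ `isClosed_borelU`, ★ `isInvInvariant_of_isMulRightInvariant`
import Literature.NumberTheory.Automorphic.UnitaryGroupLineUnipotentRing                    -- ★ rank-one LEMMA 22 ring-generic: `LineRing.lintegral_conj_eq_mul_lintegral_mul_two` (`∫_{N₂} F(u t u⁻¹) = χ⁻(b−1)⁻¹ ∫_{N₂} F(t u)`), `LineRing.map_unit_torusScalar_sub_one_two`, `LineRing.mul_comm_two` (`N₂` abelian)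
import Literature.NumberTheory.Automorphic.UnitaryGroupLineBorelRing                        -- ★ `LineRing.exists_borelHomeomorph_two` (`T₂ × N₂ ≃ₜ B₂` in the `anMap` currency), `LineRing.isClosed_unipotentU`
import HarnessLib

/-!
# h413 ∕ Track B «K2-LIT», (SC-an)₂ leaf, brick [M5](D1-split)₂: HARISH-CHANDRA'S THEOREM 14 ON THE SPLIT TORUS OF `U(σ, Φ₂)(K)` —
# `∫_{U ⧸ T} Θ(ẏ t ẏ⁻¹) dμ_{U⧸T} ≤ C · ‖Θ‖_∞ · |det(Ad t − 1)_𝔫|⁻¹` for EVERY regular diagonal `t`, one `C = C(μ_{U⧸T}, K₁, supp Θ)`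
# (Harish-Chandra 1970, Part VI §8 Theorem 14 p. 60 — the split Cartan, rank one; Part V §2 Lemma 22; the `Fin 2` twin of ★ `K2E3SplitTorusOrbitalBoundRankOne`)

Cell `pub/hodgecm-mathlib`, crux H413 = `stmt-HodgeConjecture-24833`, route of record `HCCMUnconditional`; chair K2-lead (g2), L4 LINE-LEAD ∕ dealer K2E3-plan (g4), architect
K2E3-p25 (g3).  THEOREMS ONLY (no `def`, no `instance`, no `notation`, no named-fact hypothesis, no `sorry`); lane `--supports stmt-HodgeConjecture-24833 --as helper`, count-neutral.

THE PRINT.  [HarishChandra1970, Part VI §8 Theorem 14 p. 60]: «Let `A` be a torus, `ω_A` compact in `A`, `h ∈ C_c^∞(G)`.  Then `sup_{a ∈ ω_A′} |F_h(a)| < ∞`»,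
`F_h(a) = |D(a)|^{1∕2} ∫_{G∕A} h(a^x) dx*`.  For the SPLIT Cartan `T = {d(d₀, σ(d₀)⁻¹)}` of the quasi-split `U(1,1) = U(σ, Φ₂)(K)` (rank one, the `H = U(Φ₂) × U(Φ₁)` side of
[Rogawski1990, Prop. 4.9.1 (b)]) the proof is the template's with a ONE-dimensional abelian radical: (i) TORUS DESCENT in Iwasawa coordinates `U = K₁·T·N` — `∫_{U⧸T} Θ(ẏ t ẏ⁻¹)
dμ = C ∫_{K₁} ∫_N Θ(k n t n⁻¹ k⁻¹) dn dk` (★ FILE A `TorusOrbitalDescentTwist`, generic); (ii) the REGULAR TWIST `n ↦ n t n⁻¹ = t·ψ_t(n)` of the LINE radical `N₂ ≅ K⁻ =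
{x : σ x = −x}` [HarishChandra1970, Part V §2 Lemma 22 p. 42] — `∫_N Θ(k n t n⁻¹ k⁻¹) dn = J(t) ∫_N Θ(k t n k⁻¹) dn`, `J(t) = |det(Ad t − 1)_𝔫|⁻¹ = χ⁻(b − 1)⁻¹`,
`b = d₀⁻¹d₁` (★ ring-generic `LineRing.lintegral_conj_eq_mul_lintegral_mul_two`, ONE factor where `U(Φ₃)` had two); (iii) the FIBRE BOUND, UNIFORM IN `t` (★ the template's
GENERIC §1 `exists_isCompact_lintegral_prod_conj_le` BY NAME, with `B₂ = T₂ × N₂` topologically by ★ `LineRing.exists_borelHomeomorph_two`).  Altogether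
**`∫_{U⧸T} Θ(ẏ t ẏ⁻¹) dμ_{U⧸T} ≤ C·‖Θ‖_∞·χ⁻(b−1)⁻¹`** for EVERY regular diagonal `t` — with `χ⁻(b−1)⁻¹ = |D_G(t)|^{−1∕2}·δ_B(t)^{−1∕2}` (★ `LineRing.twistModule_two_eq_inv_sqrt`:
`= (√‖b−1‖_K)⁻¹` given a `σ`-skew unit).

CURRENCY = the template's model currency at `Fin 2`: `U = ↥(unitaryGroupOfForm σ J)` over an abstract locally compact second countable Hausdorff topological field `K` with a
continuous involution `σ`, `hJ : J = (StdForm.antidiagonal 2).over K`, `T = torusU σ J`, `N = unipotentU σ J`, `B = borelU σ J`; the quotient `↥U ⧸ torusU σ J` with a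
CONSUMER-SUPPLIED Borel structure and ANY `U`-invariant measure `μQ` finite on compacta; the orbital integrand ★ `descConj t (torusU σ J) ht Θ`.  Neither `σ ∘ σ = id` nor
`(2 : K) ≠ 0` is needed in rank one (the template's `hσ`∕`h2` fed ★ `HeisRing` only): the heads take `σ hσc hJ` where the template takes `σ hσ hσc h2 hJ`.  EVERY structural hypothesis of ★ FILE A is discharged ring-generically (`N₂` abelian ★ `LineRing.mul_comm_two` ⇒ its
Haar measures are inversion invariant, ★ `isInvInvariant_of_comm`; ★ `isClosed_torusU_of_t1Space`, ★ `LineRing.isClosed_unipotentU`, ★ `isClosed_borelU`, ★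
`LineRing.conj_mem_unipotentU_of_mem_torusU`) EXCEPT the two binders that are theorems only at a place `K = L_w` and stay HYPOTHESES here, exactly as in the template: `hKB` —
the Iwasawa decomposition `U = K₁·B` (at `L_w`: ★ `K2E3SplitTorusOrbitalBoundPlaceTwo` §1) — and `hunimod` — every Haar measure of `U` is right invariant (at `L_w`: ★ [M2a]₂
`K2E3SupercuspModelFrameAtPlaceTwo.isMulRightInvariant_of_isHaarMeasure_of_eq_over`).

* §1 THE HEAD **`exists_const_lintegral_descConj_torusU_le`** — `∃ C : ℝ≥0, ∀ Θ` (measurable, `= 0` off `S`, `≤ M`), `∀ t = diag d ∈ T` regular (`d₀⁻¹d₁ − 1` a unit),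
  `∫⁻ q, descConj t (torusU σ J) ht Θ q ∂μQ ≤ C * M * ↑(χ⁻(b−1))⁻¹` — Lemma 22's rank-one module in its ★ token
  `HeisRing.skewModulus σ hσc hb.unit (LineRing.map_unit_torusScalar_sub_one_two σ hJ t hd hb)`.
* §2 **`exists_const_lintegral_descConj_torusU_enorm_le`** — the same for `Θ = ‖θ‖ₑ`, `θ : U → ℂ` continuous with compact support, `C = C(μQ, K₁, θ)`.

HONEST LABEL.  HC_CM is proved only modulo the 7 printed citations (2 remaining named inputs: hLiu418 = `stmt-HodgeConjecture-24832`, h413 = `stmt-HodgeConjecture-24833`)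
until rung 0 closes; count-neutral helper (an intermediate of the (SC-dom)₂ half of (SC-an)₂; nothing printed is asserted as a fact); (SC-an)₂ stays OPEN.

## References
* [HarishChandra1970] Harish-Chandra (notes by G. van Dijk), *Harmonic Analysis on Reductive p-adic Groups*, LNM 162 (1970), Part V §2 Lemma 22 p. 42; Part VI §8 Theorem 14
  p. 60; Part VII §3 pp. 71–73.
* [Rogawski1990] J. D. Rogawski, *Automorphic Representations of Unitary Groups in Three Variables*, Ann. of Math. Stud. 123 (1990), §1.10 p. 9; §3.6 p. 31; §4.9 Prop. 4.9.1 (b)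
  p. 55; §4.13 Lemma 4.13.1 (a) p. 64 and p. 70.
* [Gelbart1975] S. Gelbart, *Automorphic Forms on Adele Groups*, Ann. of Math. Stud. 83 (1975), Thm. 9.22 (iii), Remark 9.23.
* [GetzHahn2024] J. R. Getz, H. Hahn, *An Introduction to Automorphic Representations*, GTM 300 (2024), §3.5 (3.10).
-/

set_option autoImplicit false
set_option linter.dupNamespace false  -- the mandated namespace repeats the single-problem summit's segment (`HodgeConjecture.HodgeConjecture`)

noncomputable section

open MeasureTheory Measure Set Filter Topology
open scoped ENNReal NNReal Pointwise Matrix MatrixGroups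
open Literature.MeasureTheory.Group
open Literature.NumberTheory.Automorphic Literature.NumberTheory.Automorphic.UnitaryGroup Literature.NumberTheory.Rogawski1990
open Summit.HodgeConjecture.HodgeConjecture.Cruxes.H413.K2E3SplitTorusOrbitalBoundRankOne (exists_isCompact_lintegral_prod_conj_le)

namespace Summit.HodgeConjecture.HodgeConjecture.Cruxes.H413.K2E3SplitTorusOrbitalBoundRankOneTwo

/-! ## §1 The head: Theorem 14 on the split torus of `U(σ, Φ₂)(K)` -/

section Model

variable {K : Type*} [Field K] [TopologicalSpace K] [IsTopologicalRing K] [LocallyCompactSpace K] [T2Space K] [SecondCountableTopology K]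
  [MeasurableSpace K] [BorelSpace K]
  (σ : K →+* K) (hσc : Continuous σ)
  {J : Matrix (Fin 2) (Fin 2) K} (hJ : J = (StdForm.antidiagonal 2).over K)
  [MeasurableSpace ↥(unitaryGroupOfForm σ J)] [BorelSpace ↥(unitaryGroupOfForm σ J)]
  [SecondCountableTopology ↥(unitaryGroupOfForm σ J)] [LocallyCompactSpace ↥(unitaryGroupOfForm σ J)]

include hJ in
/-- **HARISH-CHANDRA'S THEOREM 14 ON THE SPLIT TORUS OF `U(σ, Φ₂)(K)`** — the normalised orbital integral over `U ⧸ T` of a bounded function with compact support is bounded by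
the module of the regular twist, UNIFORMLY over the regular diagonal elements (rank one).  Let `K₁ ≤ U` be a compact subgroup with `U = K₁·B` (`hKB`, Iwasawa), let every Haar
measure of `U` be right invariant (`hunimod`), let `μQ` be ANY `U`-invariant measure on `↥U ⧸ T`, finite on compacta, and `S ⊆ U` compact.  Then there is ONE `C : ℝ≥0` such that
for every measurable `Θ : U → [0,∞]` vanishing off `S` and bounded by `M`, and every `t = diag(d) ∈ T` with `b − 1 = d₀⁻¹d₁ − 1` a unit (i.e. `t` regular):
`∫⁻_{U⧸T} Θ(ẏ t ẏ⁻¹) dμQ ≤ C · M · χ⁻(b−1)⁻¹` — print's `|D(t)|^{1∕2} ∫_{G∕A} |θ(t^x)| dx* ≤ C_θ`, since `χ⁻(b−1)⁻¹ = |D_G(t)|^{−1∕2} δ_B(t)^{−1∕2}` on `U(1,1)`.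
Proof: ★ FILE A torus descent (all structural hypotheses discharged ring-generically at `2 × 2`) ∘ ★ rank-one Lemma 22 `LineRing.lintegral_conj_eq_mul_lintegral_mul_two` (`hJac`) ∘
★ the template's GENERIC fibre bound `exists_isCompact_lintegral_prod_conj_le`.
[cite: HarishChandra1970, Part VI §8 Theorem 14 p. 60; Part VII §3 p. 72; Part V §2 Lemma 22 p. 42] [cite: Rogawski1990, §4.13 Lemma 4.13.1 (a) p. 64, p. 70; §4.9 Prop. 4.9.1 (b) p. 55]
[cite: Gelbart1975, Thm. 9.22 (iii)] -/
theorem exists_const_lintegral_descConj_torusU_le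
    (hunimod : ∀ ν : Measure ↥(unitaryGroupOfForm σ J), ν.IsHaarMeasure → ν.IsMulRightInvariant)
    {K₁ : Subgroup ↥(unitaryGroupOfForm σ J)} (hK₁ : IsCompact (K₁ : Set ↥(unitaryGroupOfForm σ J)))
    (hKB : ∀ g : ↥(unitaryGroupOfForm σ J), ∃ k ∈ K₁, ∃ b ∈ borelU σ J, g = k * b)
    [MeasurableSpace (↥(unitaryGroupOfForm σ J) ⧸ torusU σ J)] [BorelSpace (↥(unitaryGroupOfForm σ J) ⧸ torusU σ J)]
    (μQ : Measure (↥(unitaryGroupOfForm σ J) ⧸ torusU σ J))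
    [SMulInvariantMeasure ↥(unitaryGroupOfForm σ J) (↥(unitaryGroupOfForm σ J) ⧸ torusU σ J) μQ] [IsFiniteMeasureOnCompacts μQ]
    {S : Set ↥(unitaryGroupOfForm σ J)} (hS : IsCompact S) :
    ∃ C : ℝ≥0, ∀ (Θ : ↥(unitaryGroupOfForm σ J) → ℝ≥0∞), Measurable Θ → (∀ g, Θ g ≠ 0 → g ∈ S) → ∀ (M : ℝ≥0∞), (∀ g, Θ g ≤ M) →
      ∀ (t : ↥(torusU σ J)) (ht : ∀ a ∈ torusU σ J, a * (t : ↥(unitaryGroupOfForm σ J)) = (t : ↥(unitaryGroupOfForm σ J)) * a)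
        (d : Fin 2 → Kˣ) (hd : glDiagonal 2 K d = ((t : ↥(unitaryGroupOfForm σ J)) : GL (Fin 2) K))
        (hb : IsUnit ((((d 0)⁻¹ * d 1 : Kˣ) : K) - 1)),
        ∫⁻ q, descConj (t : ↥(unitaryGroupOfForm σ J)) (torusU σ J) ht Θ q ∂μQ ≤
          C * M * (((HeisRing.skewModulus σ hσc hb.unit (LineRing.map_unit_torusScalar_sub_one_two σ hJ t hd hb))⁻¹ : ℝ≥0) : ℝ≥0∞) := by
  -- the degenerate case `μQ = 0`
  by_cases hμ : μQ = 0
  · refine ⟨0, fun Θ _ _ M _ t ht d hd hb => ?_⟩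
    rw [hμ, lintegral_zero_measure]
    exact bot_le
  -- closed subgroups, their local compactness ∕ second countability, the Haar measures
  have hT : IsClosed (torusU σ J : Set ↥(unitaryGroupOfForm σ J)) := isClosed_torusU_of_t1Space _ _
  have hN : IsClosed (unipotentU σ J : Set ↥(unitaryGroupOfForm σ J)) := LineRing.isClosed_unipotentU _ _
  have hB : IsClosed (borelU σ J : Set ↥(unitaryGroupOfForm σ J)) := isClosed_borelU _ _
  haveI : LocallyCompactSpace ↥(torusU σ J) := hT.isClosedEmbedding_subtypeVal.locallyCompactSpace
  haveI : LocallyCompactSpace ↥(unipotentU σ J) := hN.isClosedEmbedding_subtypeVal.locallyCompactSpace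
  haveI : LocallyCompactSpace ↥K₁ := hK₁.isClosed.isClosedEmbedding_subtypeVal.locallyCompactSpace
  haveI : SecondCountableTopology ↥(torusU σ J) := TopologicalSpace.Subtype.secondCountableTopology _
  haveI : SecondCountableTopology ↥(unipotentU σ J) := TopologicalSpace.Subtype.secondCountableTopology _
  haveI : SecondCountableTopology ↥K₁ := TopologicalSpace.Subtype.secondCountableTopology _
  haveI : CompactSpace ↥K₁ := isCompact_iff_compactSpace.1 hK₁
  set κ : Measure ↥K₁ := Measure.haar with hκ
  set α : Measure ↥(torusU σ J) := Measure.haar with hα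
  set μN : Measure ↥(unipotentU σ J) := Measure.haar with hμN
  set ν : Measure ↥(unitaryGroupOfForm σ J) := Measure.haar with hν
  haveI : α.IsInvInvariant :=
    Literature.MeasureTheory.Group.isInvInvariant_of_comm _ hT (fun x hx y hy => LineRing.forall_mem_torusU_comm σ J hy x hx) α
  -- `N₂` is abelian (★ `LineRing.mul_comm_two`), so its Haar measure is inversion invariant
  haveI : μN.IsInvInvariant :=
    Literature.MeasureTheory.Group.isInvInvariant_of_comm _ hN
      (fun x hx y hy => congrArg (fun u : ↥(unipotentU σ J) => ((u : ↥(unitaryGroupOfForm σ J))))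
        (LineRing.mul_comm_two σ (⟨x, hx⟩ : ↥(unipotentU σ J)) ⟨y, hy⟩)) μN
  haveI : ν.IsMulRightInvariant := hunimod ν inferInstance
  haveI : ν.IsInvInvariant := isInvInvariant_of_isMulRightInvariant ν
  -- `T × N ≃ₜ B` (★ `LineRing.exists_borelHomeomorph_two`) and the torus descent (★ FILE A) with one constant `C₀`
  obtain ⟨e, he⟩ := LineRing.exists_borelHomeomorph_two σ hJ
  obtain ⟨C₀, -, hdesc⟩ := exists_lintegral_descConj_eq_mul_lintegral_prod_torus_mul_unipotent hK₁ hT hB (torusU_le_borelU _ _)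
    (unipotentU_le_borelU _ _) (fun a ha n hn => LineRing.conj_mem_unipotentU_of_mem_torusU σ J ha hn) e he hKB ν κ α μN μQ hμ
  -- the `t`-uniform fibre bound (★ the template's GENERIC §1)
  obtain ⟨NS, hNSc, hfib⟩ := exists_isCompact_lintegral_prod_conj_le hB (torusU_le_borelU _ _) (unipotentU_le_borelU _ _) e he hK₁ hS κ μN
  have hκfin : κ univ < ∞ := IsCompact.measure_lt_top isCompact_univ
  have hNSfin : μN NS < ∞ := hNSc.measure_lt_top
  refine ⟨C₀ * (κ univ * μN NS).toNNReal, fun Θ hΘm hΘS M hΘM t ht d hd hb => ?_⟩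
  -- rank-one Lemma 22: the twist binder at the regular `t`
  have hJac : ∀ Φ : ↥(unitaryGroupOfForm σ J) → ℝ≥0∞, Measurable Φ →
      ∫⁻ n : ↥(unipotentU σ J), Φ ((n : ↥(unitaryGroupOfForm σ J)) * (t : ↥(unitaryGroupOfForm σ J)) * (n : ↥(unitaryGroupOfForm σ J))⁻¹) ∂μN =
        (((HeisRing.skewModulus σ hσc hb.unit (LineRing.map_unit_torusScalar_sub_one_two σ hJ t hd hb))⁻¹ : ℝ≥0) : ℝ≥0∞) *
          ∫⁻ n : ↥(unipotentU σ J), Φ ((t : ↥(unitaryGroupOfForm σ J)) * (n : ↥(unitaryGroupOfForm σ J))) ∂μN :=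
    fun Φ hΦ => LineRing.lintegral_conj_eq_mul_lintegral_mul_two σ hσc hJ μN t.2 hd hb Φ hΦ
  rw [hdesc (t : ↥(unitaryGroupOfForm σ J)) ht hJac Θ hΘm]
  have hle := hfib t M Θ hΘS hΘM
  have hprod : ((κ univ * μN NS).toNNReal : ℝ≥0∞) = κ univ * μN NS := ENNReal.coe_toNNReal (ENNReal.mul_ne_top hκfin.ne hNSfin.ne)
  calc (C₀ : ℝ≥0∞) * (((HeisRing.skewModulus σ hσc hb.unit (LineRing.map_unit_torusScalar_sub_one_two σ hJ t hd hb))⁻¹ : ℝ≥0) : ℝ≥0∞) *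
        ∫⁻ p : ↥K₁ × ↥(unipotentU σ J), Θ ((p.1 : ↥(unitaryGroupOfForm σ J)) * ((t : ↥(unitaryGroupOfForm σ J)) * (p.2 : ↥(unitaryGroupOfForm σ J))) *
          (p.1 : ↥(unitaryGroupOfForm σ J))⁻¹) ∂(κ.prod μN)
      ≤ (C₀ : ℝ≥0∞) * (((HeisRing.skewModulus σ hσc hb.unit (LineRing.map_unit_torusScalar_sub_one_two σ hJ t hd hb))⁻¹ : ℝ≥0) : ℝ≥0∞) *
        (M * (κ univ * μN NS)) := by gcongr
    _ = ((C₀ * (κ univ * μN NS).toNNReal : ℝ≥0) : ℝ≥0∞) * M *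
        (((HeisRing.skewModulus σ hσc hb.unit (LineRing.map_unit_torusScalar_sub_one_two σ hJ t hd hb))⁻¹ : ℝ≥0) : ℝ≥0∞) := by
        rw [show (((C₀ * (κ univ * μN NS).toNNReal : ℝ≥0)) : ℝ≥0∞) = (C₀ : ℝ≥0∞) * (κ univ * μN NS) by rw [ENNReal.coe_mul, hprod]]
        ring

/-! ## §2 The supercuspidal-coefficient shape: `Θ = ‖θ‖ₑ` for `θ` continuous with compact support -/

include hJ in
/-- **THEOREM 14 ON THE SPLIT TORUS OF `U(σ, Φ₂)(K)` FOR A CONTINUOUS COMPACTLY SUPPORTED `θ : U → ℂ`** (the supercuspidal coefficient `θ = B v₁ (ρ(·) v₁)` of the (SC-an)₂ line):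
ONE `C = C(μQ, K₁, θ) : ℝ≥0` with `∫⁻_{U⧸T} ‖θ(ẏ t ẏ⁻¹)‖ₑ dμQ ≤ C · χ⁻(b−1)⁻¹` for EVERY regular diagonal `t = diag(d)` — the `∫_{G∕A}|θ(γ^x)|dx̄ ≤ c|D(γ)|^{−1∕2}` factor of the
domination weight `W` of the (M5h)₂ chain, up to `δ_B^{−1∕2}` (bounded on height balls).
[cite: HarishChandra1970, Part VI §8 Theorem 14 p. 60; Part VII §3 p. 72] [cite: Rogawski1990, §4.13 Lemma 4.13.1 (a) p. 64, p. 70] -/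
theorem exists_const_lintegral_descConj_torusU_enorm_le
    (hunimod : ∀ ν : Measure ↥(unitaryGroupOfForm σ J), ν.IsHaarMeasure → ν.IsMulRightInvariant)
    {K₁ : Subgroup ↥(unitaryGroupOfForm σ J)} (hK₁ : IsCompact (K₁ : Set ↥(unitaryGroupOfForm σ J)))
    (hKB : ∀ g : ↥(unitaryGroupOfForm σ J), ∃ k ∈ K₁, ∃ b ∈ borelU σ J, g = k * b)
    [MeasurableSpace (↥(unitaryGroupOfForm σ J) ⧸ torusU σ J)] [BorelSpace (↥(unitaryGroupOfForm σ J) ⧸ torusU σ J)]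
    (μQ : Measure (↥(unitaryGroupOfForm σ J) ⧸ torusU σ J))
    [SMulInvariantMeasure ↥(unitaryGroupOfForm σ J) (↥(unitaryGroupOfForm σ J) ⧸ torusU σ J) μQ] [IsFiniteMeasureOnCompacts μQ]
    {θ : ↥(unitaryGroupOfForm σ J) → ℂ} (hθ : Continuous θ) (hθc : HasCompactSupport θ) :
    ∃ C : ℝ≥0, ∀ (t : ↥(torusU σ J)) (ht : ∀ a ∈ torusU σ J, a * (t : ↥(unitaryGroupOfForm σ J)) = (t : ↥(unitaryGroupOfForm σ J)) * a)
        (d : Fin 2 → Kˣ) (hd : glDiagonal 2 K d = ((t : ↥(unitaryGroupOfForm σ J)) : GL (Fin 2) K))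
        (hb : IsUnit ((((d 0)⁻¹ * d 1 : Kˣ) : K) - 1)),
        ∫⁻ q, descConj (t : ↥(unitaryGroupOfForm σ J)) (torusU σ J) ht (fun g => ‖θ g‖ₑ) q ∂μQ ≤
          C * (((HeisRing.skewModulus σ hσc hb.unit (LineRing.map_unit_torusScalar_sub_one_two σ hJ t hd hb))⁻¹ : ℝ≥0) : ℝ≥0∞) := by
  obtain ⟨C, hC⟩ := exists_const_lintegral_descConj_torusU_le σ hσc hJ hunimod hK₁ hKB μQ hθc.isCompact
  -- a bound for `‖θ‖`
  obtain ⟨M, hM⟩ := (hθ.norm.bddAbove_range_of_hasCompactSupport hθc.norm)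
  refine ⟨C * M.toNNReal, fun t ht d hd hb => ?_⟩
  have hmeas : Measurable fun g : ↥(unitaryGroupOfForm σ J) => ‖θ g‖ₑ := hθ.measurable.enorm
  have hsupp : ∀ g : ↥(unitaryGroupOfForm σ J), ‖θ g‖ₑ ≠ 0 → g ∈ tsupport θ := fun g hg =>
    subset_tsupport θ (by simpa [Function.mem_support, enorm_eq_zero] using hg)
  have hbdd : ∀ g : ↥(unitaryGroupOfForm σ J), ‖θ g‖ₑ ≤ ((M.toNNReal : ℝ≥0) : ℝ≥0∞) := fun g =>
    calc ‖θ g‖ₑ = ENNReal.ofReal ‖θ g‖ := (ofReal_norm (θ g)).symm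
      _ ≤ ENNReal.ofReal M := ENNReal.ofReal_le_ofReal (hM ⟨g, rfl⟩)
      _ = ((M.toNNReal : ℝ≥0) : ℝ≥0∞) := rfl
  refine (hC _ hmeas hsupp _ hbdd t ht d hd hb).trans_eq ?_
  simp only [ENNReal.coe_mul]

end Model

end Summit.HodgeConjecture.HodgeConjecture.Cruxes.H413.K2E3SplitTorusOrbitalBoundRankOneTwo

end
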